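import Summits.QuantumFields.BalabanUV.T4Continuum.Support.NE3QbarIterCovLiftPrep
import Summits.QuantumFields.BalabanUV.T4Continuum.Support.NE3QbarGaugeCovariance
import Summits.QuantumFields.BalabanUV.T4Continuum.Support.NE3CovariantLift
import Literature.MathematicalPhysics.QuantumFieldTheory.Balaban1983to89.B8Ineq129
import HarnessLib

/-!
# T⁴ programme, node NE3 — route Π, row Π-R (curved step), file Π-R-W4c: THE CRUX ESTIMATE —
# `‖QbarIter L (k+1) W (covLift M W φ) z κ − φ z κ‖ ≤ cruxC(d,L)·M²·x·sup_loc‖φ‖`, `M = L^{k+1}`, k-FREE, N-FREE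

NE3 (node U1b) formalisation swarm, leaf seat `b2b-balaban-t4-ne3-formalise-leaf-01` (gen 8); re-planned row Π-R-W (FINDING F-ne3leaf01g8-1,
`HOME/CLAIMS.log` 2026-08-20 ≈23:04Z).  With W3's exact identity `dirIter L (k+1) W (hatInvW φ) = QbarIter L (k+1) W (covLift M W φ)` this is what
makes `1 + E_W := QbarIter ∘ covLift` invertible by a Neumann series on the coarse lattice (W5), hence the curved smooth right inverse EXACT.
THE PROOF (all inputs BY NAME).  Read the ONE coarse bond `(z,κ)` in the REGIONAL COMB GAUGE `g = btree M W (z − t𝟙)` (`t = baseShift`): by the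
finite gauge covariance of the lift (W3 `covLift_gaugeAct`) and of the k-fold double-bar average (W4c⁰ `QbarIter_gaugeAct`),
`‖QbarIter W (covLift W φ) − φ‖(z,κ) = ‖QbarIter W′ (covLift W′ φ′) − φ′‖(z,κ)` with `W′ = W^g`, `φ′ = φ^{g∘M•}`; in that gauge every bond of the reading
region is `(regC·M·x)`-close to `1` (`NE3CombGauge.norm_comb_sub_one_le`, forward cone of the shifted base), so (i) the transported lift is the FLAT
lift up to `O(M·δ)` relative (`‖liftHol − 1‖ ≤ (d+1)M·δ`), (ii) the averaged backgrounds stay near `1` through the tower (W4c¹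
`norm_cavgIter_sub_one_le_closed`), (iii) W4b's tower estimate `norm_QbarIter_sub_linQIter_le` compares `QbarIter W′` with B7's flat `linQIter` on the
flat lift, and (iv) Π-R♭-2's exactness `linQ_M ∘ smoothLift = id` (`NE3SmoothLiftFlat.linQ_smoothLift`, via `B7Prop4Flat.linQIter_eq_linQ_pow`) returns `φ′`
EXACTLY; the level sums are k-free by W4c¹ `sum_rho_le`.

CONTENT ([folklore]; 0 sorry; 0 def): §1 regional bookkeeping (`l1_le_of_nonneg_le` — `l1_lowPart_le` is B8Ineq129's BY NAME, the forward-cone bound `norm_comb_sub_one_le_l1`,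
the block-corner bookkeeping, `norm_liftHol_sub_one_le`); §2 **`norm_QbarIter_covLift_sub_le`** (THE END) and its global-sup corollary
`norm_QbarIter_covLift_sub_le_of_sup`.

HONEST FRAMING.  Kinematics of OUR objects at one background in the multi-level small-field class (`IsUnitaryCfg`, `LevelSmall d L k x`, `SmallField W x`,
`L ≥ 2`); the constant `cruxC` is explicit and crude (no optimisation); nothing about minimisers; (P♮)_W, T-E_w and **NE3 are NOT proved**; spine PROVED
0∕9; finite T⁴ rung (B)+1 — NOT infinite volume, NOT mass gap, NOT `BetaPertH`, NOT Clay.  PLACEMENT: `Summits/QuantumFields/BalabanUV/`.  HONEST DEPENDENCY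
(cell page 1): continuum YM on T⁴ ⇐ BetaPertH ∧ nine spine estimates (0/9 proved); BetaPertH ⇐ (D1) ∧ (D4) ∧ CAP+tail; G-an2-4 gates asym, D1 and NE2/3/4.
-/

set_option autoImplicit false

open scoped BigOperators Matrix.Norms.L2Operator
open Finset

namespace Summit.QuantumFields.BalabanUV.T4Continuum.NE3QbarIterCovLift

open Literature.MathematicalPhysics.QuantumFieldTheory.Balaban1983to89
open B7Prop1Explicit B7Prop2Explicit
open B8Lemma1NonAbelian (lowPart lowPart_apply)
open B8Ineq129 (l1_lowPart_le)
open T4AveragingDeficitWall (IsUnitaryCfg SmallField Ad)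
open T4AveragingDeficitNonAbelian (Ad_sub)
open AveragingDeficitTransport (norm_Ad_of_unitary mem_U1_of_unitary)
open AveragingDeficitNearIdentity (norm_Ad_sub_le norm_hol_sub_one_le_of_bonds)
open AveragingDeficitLocality (bondsOf l1_le_of_mem_bondsOf)
open AveragingDeficitTransportCalc (mem_bondsOf_seg_iff)
open AveragingDeficitMultiLevelPrep (cavgIter LevelSmall)
open AveragingDeficitTwoLevelPrep (prop1Radius)
open AveragingDeficitBlockDensity (btree bseg btree_mem bseg_mem)
open SpreadLift (loopRad)
open B7Prop3Flat (linQ)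
open B7Prop4Flat (linQIter linQIter_eq_linQ_pow)
open BlockAverageVaryHolo (nbRad l1_sub_self)
open SmoothRefineBlocks (blk res blk_add_res res_nonneg res_le)
open NE3TangentCovariantStructure (Qbar)
open NE3TangentCovariantTower (QbarIter)
open NE3CombGauge (isUnitaryCfg_comb smallField_comb norm_comb_sub_one_le)
open NE3NestedBlockMeanCovariance (bondsOf_treeWord_box)
open NE3SmoothLiftFlat (smoothLift linQ_smoothLift)
open NE3SmoothLiftBounds (norm_smoothLift_le)
open NE3CovariantLineSumsError (Csup)
open NE3CovariantLift (liftHol covLift liftHol_mem norm_covLift_eq covLift_gaugeAct)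
open NE3QbarGaugeCovariance (QbarIter_gaugeAct)
open NE3QbarIterNearFlat (l1_smul_sub norm_QbarIter_sub_linQIter_le norm_QbarIter_le_two_mul)
open NE3QbarIterCovLiftPrep (liftC baseShift regC rhoC cruxC liftC_nonneg regC_nonneg rhoC_nonneg sum_pow_le_pow shift_le_and_l1_le
  l1_blk_sub_le norm_cavgIter_sub_one_le_closed sum_rho_le)
open AveragingDeficitLiftDefectSum (natAbs_le_l1)

noncomputable section

variable {d : ℕ} {n : Type*} [Fintype n] [DecidableEq n]

/-! ## §1 Regional bookkeeping -/

/-- `0 ≤ u ≤ v` componentwise ⇒ `|u|₁ ≤ |v|₁`. [folklore] -/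
theorem l1_le_of_nonneg_le {u v : Site d} (h0 : 0 ≤ u) (huv : u ≤ v) : l1 u ≤ l1 v := by
  unfold l1
  refine Finset.sum_le_sum fun κ _ => ?_
  have h0' := h0 κ; have h' := huv κ
  simp only [Pi.zero_apply] at h0'
  have : ((u κ).natAbs : ℤ) ≤ (v κ).natAbs := by rw [Int.natAbs_of_nonneg h0', Int.natAbs_of_nonneg (h0'.trans h')]; exact h'
  exact_mod_cast this

/-- **THE FORWARD CONE OF THE REGIONAL COMB GAUGE IS NEAR THE IDENTITY**: for `M•zb ≤ y`, `‖(W^{btree M W zb})(y,μ) − 1‖ ≤ |y − M•zb|₁·x`.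
[cite: Balaban1985Averaging, pp.24–25] -/
theorem norm_comb_sub_one_le_l1 [Nonempty n] {M : ℕ} {W : Site d → Fin d → (Matrix n n ℂ)ˣ} (hWu : IsUnitaryCfg W) {x : ℝ} (hx : 0 ≤ x)
    (hWx : SmallField W x) (zb : Site d) {y : Site d} (hy : (M : ℤ) • zb ≤ y) (μ : Fin d) :
    ‖((gaugeAct (btree M W zb) W y μ : (Matrix n n ℂ)ˣ) : Matrix n n ℂ) - 1‖ ≤ (l1 (y - (M : ℤ) • zb) : ℝ) * x :=
  (norm_comb_sub_one_le hWu hWx zb hy μ).trans (mul_le_mul_of_nonneg_right (by exact_mod_cast l1_lowPart_le μ _) hx)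

/-- The block corner of a ball point lies in the forward cone of the shifted base, at ℓ¹-distance `≤ M·(nbRad + d + d·t)` from it (`t = baseShift`). [folklore] -/
theorem corner_bookkeeping {L M : ℕ} (hM : 1 ≤ M) {y z : Site d} (hy : l1 (y - (M : ℤ) • z) ≤ M * nbRad d L)
    (zb : Site d) (hzb : zb = fun i => z i - (baseShift d L : ℤ)) :
    (M : ℤ) • zb ≤ (M : ℤ) • blk M y ∧ l1 ((M : ℤ) • blk M y - (M : ℤ) • zb) ≤ M * (nbRad d L + d + d * baseShift d L) := by
  have hblk := l1_blk_sub_le (d := d) hM hy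
  have hcoord : ∀ i, ((blk M y - z) i).natAbs ≤ nbRad d L + d := fun i => (natAbs_le_l1 _ i).trans hblk
  have hle : zb ≤ blk M y := by
    intro i
    have h := hcoord i
    simp only [Pi.sub_apply] at h
    rw [hzb]
    have h' : |blk M y i - z i| ≤ ((nbRad d L + d : ℕ) : ℤ) := by rw [Int.abs_eq_natAbs]; exact_mod_cast h
    obtain ⟨h1, -⟩ := abs_le.mp h'
    simp only [baseShift]; push_cast at h1 ⊢; omega
  refine ⟨fun i => by simpa only [Pi.smul_apply, smul_eq_mul] using mul_le_mul_of_nonneg_left (hle i) (by positivity), ?_⟩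
  rw [l1_smul_sub]
  refine Nat.mul_le_mul_left _ ?_
  have hsplit : blk M y - zb = (blk M y - z) + (fun _ => (baseShift d L : ℤ)) := by
    rw [hzb]; funext i; simp only [Pi.sub_apply, Pi.add_apply]; ring
  rw [hsplit]
  refine (l1_add_le _ _).trans ?_
  have hconst : l1 (fun _ : Fin d => (baseShift d L : ℤ)) = d * baseShift d L := by
    unfold l1; rw [Finset.sum_const, Finset.card_univ, Fintype.card_fin, Int.natAbs_natCast, smul_eq_mul]
  rw [hconst]; omega

/-- **THE TRANSPORT OF THE LIFT IS NEAR THE IDENTITY IN THE REGIONAL GAUGE**: if every bond `b` with `M•zb ≤ b₋` and `|b₋ − M•zb|₁ ≤ R + (d+1)·M`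
is within `δ` of `1`, and the block corner of `y` satisfies `M•zb ≤ M•blk y`, `|M•blk y − M•zb|₁ ≤ R`, then `‖liftHol M W y μ − 1‖ ≤ (d+1)·M·δ`
(`M ≥ 1`, `d ≥ 1`). [folklore] -/
theorem norm_liftHol_sub_one_le [Nonempty n] {M : ℕ} (hM : 1 ≤ M) (hd : 1 ≤ d) {W : Site d → Fin d → (Matrix n n ℂ)ˣ} (hWu : IsUnitaryCfg W)
    {zb : Site d} {R : ℕ} {δ : ℝ} (hδ0 : 0 ≤ δ)
    (hW : ∀ (b : Site d) (ν : Fin d), (M : ℤ) • zb ≤ b → l1 (b - (M : ℤ) • zb) ≤ R + (d + 1) * M → ‖((W b ν : (Matrix n n ℂ)ˣ) : Matrix n n ℂ) - 1‖ ≤ δ)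
    {y : Site d} (hc1 : (M : ℤ) • zb ≤ (M : ℤ) • blk M y) (hc2 : l1 ((M : ℤ) • blk M y - (M : ℤ) • zb) ≤ R) (μ : Fin d) :
    ‖((liftHol M W y μ : (Matrix n n ℂ)ˣ) : Matrix n n ℂ) - 1‖ ≤ ((d : ℝ) + 1) * M * δ := by
  set q : Site d := (M : ℤ) • blk M y with hq
  set v : Site d := y + e μ - q with hv
  -- the tree word offset `v = res y + e_μ` is non-negative with `|v|₁ ≤ d·M`
  have hvres : v = res M y + e μ := by
    funext i
    have h := congr_fun (blk_add_res M y) i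
    simp only [hv, hq, Pi.add_apply, Pi.sub_apply, Pi.smul_apply, smul_eq_mul] at h ⊢
    linarith
  have hv0 : 0 ≤ v := fun i => by
    rw [hvres]; simp only [Pi.add_apply, Pi.zero_apply, e_apply]
    have := res_nonneg hM y i; split_ifs <;> linarith
  have hvl1 : l1 v ≤ d * M := by
    rw [hvres]
    refine (l1_add_le _ _).trans ?_
    rw [show l1 (e μ : Site d) = 1 by simpa using l1_zsmul_e (d := d) 1 μ]
    have hres : l1 (res M y) ≤ d * (M - 1) := by
      unfold l1
      calc ∑ κ : Fin d, (res M y κ).natAbs ≤ ∑ _κ : Fin d, (M - 1) := Finset.sum_le_sum fun κ _ => by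
              have h0 := res_nonneg hM y κ
              have h1 := res_le hM y κ
              have : ((res M y κ).natAbs : ℤ) ≤ (M : ℤ) - 1 := by rw [Int.natAbs_of_nonneg h0]; exact h1
              omega
        _ = d * (M - 1) := by rw [Finset.sum_const, Finset.card_univ, Fintype.card_fin, smul_eq_mul]
    have : d * (M - 1) + 1 ≤ d * M := by
      have h := Nat.sub_add_cancel hM
      nlinarith
    omega
  -- (a) the tree transport
  have htree : ‖((btree M W (blk M y) (y + e μ) : (Matrix n n ℂ)ˣ) : Matrix n n ℂ) - 1‖ ≤ (d * M : ℕ) * δ := by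
    have hw : btree M W (blk M y) (y + e μ) = hol W q (treeWord v) := rfl
    rw [hw]
    have h := norm_hol_sub_one_le_of_bonds hWu q (treeWord v) fun b hb => by
      obtain ⟨hb1, hb2⟩ := bondsOf_treeWord_box v hv0 q b hb
      refine hW b.1 b.2 (hc1.trans hb1) ?_
      have hsplit : b.1 - (M : ℤ) • zb = (b.1 - q) + (q - (M : ℤ) • zb) := by abel
      rw [hsplit]
      refine (l1_add_le _ _).trans ?_
      have hb1' : l1 (b.1 - q) ≤ l1 v := l1_le_of_nonneg_le (fun i => by have := hb1 i; simp only [Pi.sub_apply, Pi.zero_apply]; linarith)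
        (fun i => by have := hb2 i; simp only [Pi.add_apply, Pi.sub_apply, e_apply] at this ⊢; split_ifs at this <;> linarith)
      nlinarith [hvl1, hc2]
    rw [length_treeWord] at h
    exact h.trans (mul_le_mul_of_nonneg_right (by exact_mod_cast hvl1) hδ0)
  -- (b) the straight transport
  have hseg : ‖((bseg M W (blk M y) μ : (Matrix n n ℂ)ˣ) : Matrix n n ℂ) - 1‖ ≤ (M : ℝ) * δ := by
    have hw : bseg M W (blk M y) μ = hol W q (seg μ (M : ℤ)) := rfl
    rw [hw]
    have h := norm_hol_sub_one_le_of_bonds hWu q (seg μ (M : ℤ)) fun b hb => by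
      obtain ⟨j, hj, rfl⟩ := (mem_bondsOf_seg_iff q μ M b).mp hb
      refine hW _ _ (hc1.trans fun i => ?_) ?_
      · simp only [Pi.add_apply, Pi.smul_apply, e_apply, smul_eq_mul]; split_ifs <;> simp
      · have hsplit : q + (j : ℤ) • e μ - (M : ℤ) • zb = (j : ℤ) • e μ + (q - (M : ℤ) • zb) := by abel
        rw [hsplit]
        refine (l1_add_le _ _).trans ?_
        rw [l1_zsmul_e, Int.natAbs_natCast]
        nlinarith [hc2]
    rw [length_seg, Int.natAbs_natCast] at h
    exact h
  -- assemble: `liftHol = btree⁻¹ · bseg`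
  have hbu : btree M W (blk M y) (y + e μ) ∈ unitaryUnits (Matrix n n ℂ) := btree_mem hWu M _ _
  have hn1 : ‖(((btree M W (blk M y) (y + e μ))⁻¹ : (Matrix n n ℂ)ˣ) : Matrix n n ℂ)‖ ≤ 1 :=
    (CStarRing.norm_of_mem_unitary (mem_unitaryUnits.mp ((unitaryUnits _).inv_mem hbu))).le
  have hinv : ‖(((btree M W (blk M y) (y + e μ))⁻¹ : (Matrix n n ℂ)ˣ) : Matrix n n ℂ) - 1‖ ≤ (d * M : ℕ) * δ :=
    (norm_inv_sub_one_le (mem_U1_of_unitary hbu)).trans htree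
  unfold liftHol
  rw [Units.val_mul]
  calc _ ≤ ‖(((btree M W (blk M y) (y + e μ))⁻¹ : (Matrix n n ℂ)ˣ) : Matrix n n ℂ) - 1‖ + ‖((bseg M W (blk M y) μ : (Matrix n n ℂ)ˣ) : Matrix n n ℂ) - 1‖ :=
        B8Ineq170.norm_mul_sub_one_le_of_norm_le_one hn1
    _ ≤ (d * M : ℕ) * δ + M * δ := add_le_add hinv hseg
    _ = ((d : ℝ) + 1) * M * δ := by push_cast; ring

/-! ## §2 The crux estimate -/

/-- **THE CRUX ESTIMATE OF ROUTE Π's SMOOTH RIGHT INVERSE.**  For `L ≥ 2`, a unitary `W` in the multi-level small-field class (`0 ≤ x`,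
`LevelSmall d L k x`, `SmallField W x`), every coarse field `φ` with `‖φ(z′,κ′)‖ ≤ s` for `|z′ − z|₁ ≤ nbRad + d`, and every coarse bond `(z,κ)`:
`‖QbarIter L (k+1) W (covLift (L^{k+1}) W φ) z κ − φ z κ‖ ≤ cruxC d L · (L^{k+1})² · x · s` — k-FREE, N-FREE. [folklore] -/
theorem norm_QbarIter_covLift_sub_le [Nonempty n] {L : ℕ} (hL : 2 ≤ L) (k : ℕ) {W : Site d → Fin d → (Matrix n n ℂ)ˣ} {x : ℝ}
    (hWu : IsUnitaryCfg W) (hx : 0 ≤ x) (hs : LevelSmall d L k x) (hWx : SmallField W x) (φ : Site d → Fin d → Matrix n n ℂ)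
    (z : Site d) (κ : Fin d) {s : ℝ} (hs0 : 0 ≤ s) (hφ : ∀ (z' : Site d) (κ' : Fin d), l1 (z' - z) ≤ nbRad d L + d → ‖φ z' κ'‖ ≤ s) :
    ‖QbarIter L (k + 1) W (covLift (L ^ (k + 1)) W φ) z κ - φ z κ‖ ≤ cruxC d L * (((L : ℝ) ^ (k + 1)) ^ 2 * x) * s := by
  have hL1 : 1 ≤ L := by omega
  have hd : 1 ≤ d := κ.pos
  set M : ℕ := L ^ (k + 1) with hMdef
  have hM2 : 2 ≤ M := by
    rw [hMdef]; calc 2 ≤ L := hL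
      _ = L ^ 1 := (pow_one L).symm
      _ ≤ L ^ (k + 1) := Nat.pow_le_pow_right (by omega) (by omega)
  have hM1 : 1 ≤ M := by omega
  have hMz : ((M : ℕ) : ℤ) = (L : ℤ) ^ (k + 1) := by rw [hMdef]; push_cast; ring
  have hMr : ((M : ℕ) : ℝ) = (L : ℝ) ^ (k + 1) := by rw [hMdef]; push_cast; ring
  have hM0 : (0 : ℝ) < (M : ℝ) := by exact_mod_cast (by omega : 0 < M)
  -- the regional comb gauge
  set t : ℕ := baseShift d L with ht
  set zb : Site d := fun i => z i - (t : ℤ) with hzb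
  set g : Site d → (Matrix n n ℂ)ˣ := btree M W zb with hg
  set W' : Site d → Fin d → (Matrix n n ℂ)ˣ := gaugeAct g W with hW'
  set φ' : Site d → Fin d → Matrix n n ℂ := fun w ν => Ad (g ((M : ℤ) • (w + e ν))) (φ w ν) with hφ'
  set Y : Site d → Fin d → Matrix n n ℂ := covLift M W φ with hY
  set Y' : Site d → Fin d → Matrix n n ℂ := covLift M W' φ' with hY'
  set F : Site d → Fin d → Matrix n n ℂ := smoothLift M φ' with hF
  have hgu : ∀ w, g w ∈ unitaryUnits (Matrix n n ℂ) := fun w => btree_mem hWu M zb w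
  have hW'u : IsUnitaryCfg W' := isUnitaryCfg_comb hWu M zb
  have hW'x : SmallField W' x := smallField_comb hWu hWx M zb
  -- (1) covariance: move to the regional gauge
  have hYg : Y' = fun w ν => Ad (g (w + e ν)) (Y w ν) := by rw [hY', hY, hW', hφ']; exact covLift_gaugeAct M g W φ
  have hQ : QbarIter L (k + 1) W' Y' z κ = Ad (g ((M : ℤ) • (z + e κ))) (QbarIter L (k + 1) W Y z κ) := by
    rw [hYg, hW', QbarIter_gaugeAct hL1 k hWu hx hs hWx hgu Y, hMz]
  have hnorm : ‖QbarIter L (k + 1) W Y z κ - φ z κ‖ = ‖QbarIter L (k + 1) W' Y' z κ - φ' z κ‖ := by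
    rw [hQ]
    show _ = ‖Ad (g ((M : ℤ) • (z + e κ))) (QbarIter L (k + 1) W Y z κ) - Ad (g ((M : ℤ) • (z + e κ))) (φ z κ)‖
    rw [← Ad_sub, norm_Ad_of_unitary (hgu _)]
  -- (2) the flat exactness: `φ′ z κ = linQIter L F (k+1) z κ`
  have hflat : linQIter L F (k + 1) z κ = φ' z κ := by
    rw [linQIter_eq_linQ_pow, ← hMdef, hF]
    exact linQ_smoothLift hM2 φ' z κ
  -- (3) the near-identity datum of the regional gauge on the whole reading region
  set δ : ℝ := regC d L * (L : ℝ) ^ (k + 1) * x with hδ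
  have hδ0 : 0 ≤ δ := by rw [hδ]; have := regC_nonneg d L; positivity
  have hreg : ∀ (b : Site d) (ν : Fin d), (M : ℤ) • zb ≤ b → (l1 (b - (M : ℤ) • zb) : ℝ) ≤ regC d L * M →
      ‖((W' b ν : (Matrix n n ℂ)ˣ) : Matrix n n ℂ) - 1‖ ≤ δ := by
    intro b ν hb hl
    refine (norm_comb_sub_one_le_l1 hWu hx hWx zb hb ν).trans ?_
    rw [hδ, ← hMr]
    exact mul_le_mul_of_nonneg_right hl hx
  -- (3a) on the fine ball `B_{k+1}`
  have hballR : nbRad d L * ∑ i ∈ Finset.range (k + 1), L ^ i ≤ M * nbRad d L := by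
    rw [mul_comm]; exact Nat.mul_le_mul_right _ (by rw [hMdef]; exact sum_pow_le_pow hL (k + 1))
  have hball : ∀ (b : Site d) (ν : Fin d), l1 (b - ((L : ℤ) ^ (k + 1)) • z) ≤ nbRad d L * ∑ i ∈ Finset.range (k + 1), L ^ i →
      ‖((W' b ν : (Matrix n n ℂ)ˣ) : Matrix n n ℂ) - 1‖ ≤ δ := by
    intro b ν hb
    rw [← hMz] at hb
    have hb' : l1 (b - (M : ℤ) • z) ≤ M * nbRad d L := hb.trans hballR
    obtain ⟨h1, h2⟩ := shift_le_and_l1_le (t := t) hb' (Nat.mul_le_mul_left _ (by rw [ht, baseShift]; omega))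
    refine hreg b ν h1 ?_
    have h2' : (l1 (b - (M : ℤ) • zb) : ℝ) ≤ M * nbRad d L + d * (M * t) := by exact_mod_cast h2
    refine h2'.trans ?_
    rw [regC, ht]; nlinarith [hM0.le, (Nat.cast_nonneg d : (0:ℝ) ≤ d), (Nat.cast_nonneg (baseShift d L) : (0:ℝ) ≤ _)]
  -- (3b) the sup of the regional lift on the fine ball: `‖Y′‖ ≤ liftC∕M · s`
  set s₀ : ℝ := liftC d / M * s with hs₀
  have hs₀0 : 0 ≤ s₀ := by rw [hs₀]; have := liftC_nonneg d; positivity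
  have hsup : ∀ (b : Site d) (ν : Fin d), l1 (b - ((L : ℤ) ^ (k + 1)) • z) ≤ nbRad d L * ∑ i ∈ Finset.range (k + 1), L ^ i → ‖Y' b ν‖ ≤ s₀ := by
    intro b ν hb
    rw [← hMz] at hb
    have hb' : l1 (b - (M : ℤ) • z) ≤ M * nbRad d L := hb.trans hballR
    have hloc := l1_blk_sub_le (d := d) hM1 hb'
    rw [hY', norm_covLift_eq hW'u, ← hF]
    refine (norm_smoothLift_le hM2 hd φ' b ν).trans ?_
    rw [hs₀, liftC]
    refine mul_le_mul_of_nonneg_left ?_ (by positivity)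
    rw [hφ']; dsimp only
    rw [norm_Ad_of_unitary (hgu _)]
    exact hφ _ _ hloc
  -- (3c) the lift against the flat lift on the fine ball
  set e : ℝ := 2 * (((d : ℝ) + 1) * M * δ) * s₀ with he
  have herr : ∀ (b : Site d) (ν : Fin d), l1 (b - ((L : ℤ) ^ (k + 1)) • z) ≤ nbRad d L * ∑ i ∈ Finset.range (k + 1), L ^ i →
      ‖Y' b ν - F b ν‖ ≤ e := by
    intro b ν hb
    have hFb : ‖F b ν‖ ≤ s₀ := by have := hsup b ν hb; rwa [hY', norm_covLift_eq hW'u, ← hF] at this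
    rw [← hMz] at hb
    have hb' : l1 (b - (M : ℤ) • z) ≤ M * nbRad d L := hb.trans hballR
    obtain ⟨hc1, hc2⟩ := corner_bookkeeping (L := L) hM1 hb' zb hzb
    have hτ := norm_liftHol_sub_one_le hM1 hd hW'u (zb := zb) (R := M * (nbRad d L + d + d * baseShift d L)) hδ0
      (fun b' ν' hb1 hb2 => hreg b' ν' hb1 (by
        have : (l1 (b' - (M : ℤ) • zb) : ℝ) ≤ (M * (nbRad d L + d + d * baseShift d L) + (d + 1) * M : ℕ) := by exact_mod_cast hb2
        refine this.trans ?_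
        rw [regC]; push_cast; nlinarith [hM0.le, (Nat.cast_nonneg d : (0:ℝ) ≤ d)])) hc1 hc2 ν
    have hmem := liftHol_mem hW'u M b ν
    show ‖Ad (liftHol M W' b ν) (smoothLift M φ' b ν) - F b ν‖ ≤ e
    rw [← hF]
    refine (norm_Ad_sub_le hmem _).trans ?_
    rw [he]
    have h2 : (0 : ℝ) ≤ 2 * ‖((liftHol M W' b ν : (Matrix n n ℂ)ˣ) : Matrix n n ℂ) - 1‖ := by positivity
    calc 2 * ‖((liftHol M W' b ν : (Matrix n n ℂ)ˣ) : Matrix n n ℂ) - 1‖ * ‖F b ν‖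
        ≤ 2 * ‖((liftHol M W' b ν : (Matrix n n ℂ)ˣ) : Matrix n n ℂ) - 1‖ * s₀ := mul_le_mul_of_nonneg_left hFb h2
      _ ≤ 2 * (((d : ℝ) + 1) * M * δ) * s₀ := mul_le_mul_of_nonneg_right (by linarith [hτ]) hs₀0
  -- (4) the tower estimate of W4b in the regional gauge
  have ha : ∀ (i m : ℕ), i + m = k → ∀ (y : Site d) (μ : Fin d),
      l1 (y - ((L : ℤ) ^ (m + 1)) • z) ≤ nbRad d L * ∑ i ∈ Finset.range (m + 1), L ^ i →
      ‖((cavgIter L i W' y μ : (Matrix n n ℂ)ˣ) : Matrix n n ℂ) - 1‖ ≤ (L : ℝ) ^ i * δ + 2 * loopRad d L ((prop1Radius d L)^[i] x) :=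
    fun i m him y μ hy => norm_cavgIter_sub_one_le_closed hL hW'u hx hs hW'x z hball i (m + 1) (by omega) y μ hy
  have hb : ∀ (i m : ℕ), i + m = k → ∀ (y : Site d) (μ : Fin d),
      l1 (y - ((L : ℤ) ^ (m + 1)) • z) ≤ nbRad d L * ∑ i ∈ Finset.range (m + 1), L ^ i → ‖QbarIter L i W' Y' y μ‖ ≤ (L : ℝ) ^ i * (2 * s₀) := by
    intro i m him y μ hy
    have h := norm_QbarIter_le_two_mul hL k hW'u hx hs hW'x Y' z hs₀0 hsup i (m + 1) (by omega) y μ hy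
    linarith
  have hmain := norm_QbarIter_sub_linQIter_le hL1 k hW'u hx hs hW'x Y' F z κ (fun i => (L : ℝ) ^ i * δ + 2 * loopRad d L ((prop1Radius d L)^[i] x))
    ha hb herr
  -- (5) arithmetic
  have hsum := sum_rho_le (d := d) hL k hx hs
  rw [← hδ] at hsum
  have hLk : (0 : ℝ) ≤ (L : ℝ) ^ k * (2 * s₀) := by positivity
  rw [hY.symm.symm] at hnorm
  rw [hnorm, ← hflat]
  refine hmain.trans ?_
  have hstep1 : (L : ℝ) ^ k * (2 * s₀) * ∑ i ∈ Finset.range (k + 1),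
        ((2 * (d : ℝ) + 4) * (L : ℝ) ^ 2 * ((L : ℝ) ^ i * δ + 2 * loopRad d L ((prop1Radius d L)^[i] x))
          + (8 * (L : ℝ) + Csup d L) * loopRad d L ((prop1Radius d L)^[i] x))
      ≤ (L : ℝ) ^ k * (2 * s₀) * (rhoC d L * (((L : ℝ) ^ (k + 1)) ^ 2 * x)) := mul_le_mul_of_nonneg_left hsum hLk
  refine (add_le_add le_rfl hstep1).trans ?_
  -- substitute `e`, `s₀`, `δ` and compare with `cruxC`
  have hLr : (L : ℝ) ^ (k + 1) = (L : ℝ) ^ k * L := pow_succ _ _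
  have hL0 : (0 : ℝ) < L := by exact_mod_cast (by omega : 0 < L)
  rw [he, hs₀, hδ, ← hMr, cruxC]
  -- everything is a multiple of `M²·x·s`; clear the divisions by `M` and `L`
  rw [div_mul_eq_mul_div, hMr]
  have hA0 : (0 : ℝ) < (L : ℝ) ^ (k + 1) := by positivity
  have hLk0 : (0 : ℝ) < (L : ℝ) ^ k := by positivity
  have hMx : (0 : ℝ) ≤ ((L : ℝ) ^ (k + 1)) ^ 2 * x := by positivity
  calc (L : ℝ) ^ (k + 1) * (2 * (((d : ℝ) + 1) * (L : ℝ) ^ (k + 1) * (regC d L * (L : ℝ) ^ (k + 1) * x)) * (liftC d * s / (L : ℝ) ^ (k + 1)))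
        + (L : ℝ) ^ k * (2 * (liftC d * s / (L : ℝ) ^ (k + 1))) * (rhoC d L * (((L : ℝ) ^ (k + 1)) ^ 2 * x))
      = (2 * ((d : ℝ) + 1) * regC d L * liftC d + 2 * liftC d * rhoC d L / L) * ((((L : ℝ) ^ (k + 1)) ^ 2 * x) * s) := by
        rw [hLr]; field_simp
    _ ≤ 2 * liftC d * (2 * ((d : ℝ) + 1) * regC d L + rhoC d L / L) * (((L : ℝ) ^ (k + 1)) ^ 2 * x) * s := by
        have hslack : 0 ≤ 2 * ((d : ℝ) + 1) * regC d L * liftC d * ((((L : ℝ) ^ (k + 1)) ^ 2 * x) * s) :=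
          mul_nonneg (by have := regC_nonneg d L; have := liftC_nonneg d; positivity) (mul_nonneg hMx hs0)
        have hid : 2 * liftC d * (2 * ((d : ℝ) + 1) * regC d L + rhoC d L / L) * (((L : ℝ) ^ (k + 1)) ^ 2 * x) * s
            = (2 * ((d : ℝ) + 1) * regC d L * liftC d + 2 * liftC d * rhoC d L / L) * ((((L : ℝ) ^ (k + 1)) ^ 2 * x) * s)
              + 2 * ((d : ℝ) + 1) * regC d L * liftC d * ((((L : ℝ) ^ (k + 1)) ^ 2 * x) * s) := by ring
        rw [hid]; linarith

/-- **GLOBAL-SUP COROLLARY**: for `‖φ‖_∞ ≤ s`, `‖QbarIter L (k+1) W (covLift (L^{k+1}) W φ) z κ − φ z κ‖ ≤ cruxC d L·(L^{k+1})²·x·s` at every `(z,κ)`. [folklore] -/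
theorem norm_QbarIter_covLift_sub_le_of_sup [Nonempty n] {L : ℕ} (hL : 2 ≤ L) (k : ℕ) {W : Site d → Fin d → (Matrix n n ℂ)ˣ} {x : ℝ}
    (hWu : IsUnitaryCfg W) (hx : 0 ≤ x) (hs : LevelSmall d L k x) (hWx : SmallField W x) (φ : Site d → Fin d → Matrix n n ℂ)
    {s : ℝ} (hs0 : 0 ≤ s) (hφ : ∀ (z' : Site d) (κ' : Fin d), ‖φ z' κ'‖ ≤ s) (z : Site d) (κ : Fin d) :
    ‖QbarIter L (k + 1) W (covLift (L ^ (k + 1)) W φ) z κ - φ z κ‖ ≤ cruxC d L * (((L : ℝ) ^ (k + 1)) ^ 2 * x) * s :=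
  norm_QbarIter_covLift_sub_le hL k hWu hx hs hWx φ z κ hs0 fun z' κ' _ => hφ z' κ'

end

end Summit.QuantumFields.BalabanUV.T4Continuum.NE3QbarIterCovLift
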